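import Mathlib.Algebra.Order.BigOperators.Group.Finset
import Mathlib.Algebra.BigOperators.Ring.Finset
import Mathlib.Algebra.Order.Field.Basic
import Mathlib.Data.Real.Basic
import Mathlib.Tactic.Linarith
import Mathlib.Tactic.Ring
import Mathlib.Tactic.FieldSimp
import Mathlib.Tactic.Positivity
import HarnessLib

/-!
# `NoHeavyLowerTail` (crux stmt-CriticalPhenomena-4575), P2 — THEOREM C part B1: the TOP-DOWN WATER-FILLING ratio on a chain

Memo SAHI-ROUTE.md §4.29(c) (seat `prim-masterthm-p2`, gen 8).  Pure real-sequence lemmas; no `sorry`, standard axioms.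

Levels of a finite chain are indexed TOP-DOWN by `k = 0, 1, …, n` (`k = 0` the top), with weights `w k > 0`.  Given the surplus profile
`e k` (in the application `e = Ȳ − EH·F`), the water-filled profile is `z 0 = e 0`, `z (k+1) = min (e (k+1)) (A k)` where `A k` is the
`w`-average of `z` over the block `0..k` above.  This file: the recursion (`SW`, `z`, `A`), the closed forms of the running sums, the
monotonicity of `A`, and TOP-HEAVINESS `S k · W n ≥ W k · S n` (`S`, `W` the running sums of `w z` and `w`), plus a weighted Chebyshev
inequality on blocks and the lower bound `z ≥ F·κ` giving `A ≥ 0` under the environment hypotheses (`e ≥ F κ`, `F ≥ 0` and `κ` antitone,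
block averages of `κ` nonnegative).
-/

noncomputable section

namespace Summit.CriticalPhenomena.PercolationContinuityZ3.Theorems

namespace SahiSharedChain

open Finset

variable (w e : ℕ → ℝ)

/-- Running pair `(S k, W k) = (Σ_{j≤k} w j z j, Σ_{j≤k} w j)` of the water-filling recursion. [this work] -/
def SW : ℕ → ℝ × ℝ
  | 0 => (w 0 * e 0, w 0)
  | k + 1 => ((SW k).1 + w (k + 1) * min (e (k + 1)) ((SW k).1 / (SW k).2), (SW k).2 + w (k + 1))

/-- Block average `A k = S k / W k` of the water-filled profile over the top block `0..k`. [this work] -/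
def A (k : ℕ) : ℝ := (SW w e k).1 / (SW w e k).2

/-- The water-filled profile: `z 0 = e 0`, `z (k+1) = min (e (k+1)) (A k)`. [this work] -/
def z : ℕ → ℝ
  | 0 => e 0
  | k + 1 => min (e (k + 1)) (A w e k)

variable {w e}

/-- One step of the recursion, first component. [this work] -/
theorem SW_succ_fst (k : ℕ) : (SW w e (k + 1)).1 = (SW w e k).1 + w (k + 1) * z w e (k + 1) := rfl

/-- One step of the recursion, second component. [this work] -/
theorem SW_succ_snd (k : ℕ) : (SW w e (k + 1)).2 = (SW w e k).2 + w (k + 1) := rfl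

/-- `W k = Σ_{j ≤ k} w j`. [this work] -/
theorem SW_snd (k : ℕ) : (SW w e k).2 = ∑ j ∈ range (k + 1), w j := by
  induction k with
  | zero => simp [SW]
  | succ k ih => rw [SW_succ_snd, ih, sum_range_succ _ (k + 1)]

/-- `S k = Σ_{j ≤ k} w j z j`. [this work] -/
theorem SW_fst (k : ℕ) : (SW w e k).1 = ∑ j ∈ range (k + 1), w j * z w e j := by
  induction k with
  | zero => simp [SW, z]
  | succ k ih => rw [SW_succ_fst, ih, sum_range_succ _ (k + 1)]

/-- `z ≤ e`. [this work] -/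
theorem z_le_e (k : ℕ) : z w e k ≤ e k := by
  cases k with
  | zero => simp [z]
  | succ k => exact min_le_left _ _

/-- `z (k+1) ≤ A k`. [this work] -/
theorem z_succ_le_A (k : ℕ) : z w e (k + 1) ≤ A w e k := min_le_right _ _

/-- `W k > 0` for positive weights. [this work] -/
theorem W_pos (hw : ∀ k, 0 < w k) (k : ℕ) : 0 < (SW w e k).2 := by
  rw [SW_snd]; exact sum_pos (fun j _ => hw j) ⟨0, by simp⟩

/-- `S = A · W`. [this work] -/
theorem S_eq_A_mul_W (hw : ∀ k, 0 < w k) (k : ℕ) : (SW w e k).1 = A w e k * (SW w e k).2 := by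
  unfold A; rw [div_mul_cancel₀ _ (W_pos (e := e) hw k).ne']

/-- `A` is non-increasing in `k` (each new level enters below the current average). [this work] -/
theorem A_succ_le (hw : ∀ k, 0 < w k) (k : ℕ) : A w e (k + 1) ≤ A w e k := by
  have hW := W_pos (e := e) hw k; have hW1 := W_pos (e := e) hw (k + 1); have hwk := hw (k + 1)
  have hz : z w e (k + 1) ≤ A w e k := z_succ_le_A k
  have h1 := S_eq_A_mul_W (e := e) hw (k + 1)
  have h0 := S_eq_A_mul_W (e := e) hw k
  rw [SW_succ_fst, SW_succ_snd, h0] at h1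
  -- h1 : A k * W k + w (k+1) z (k+1) = A (k+1) * (W k + w (k+1))
  rw [SW_succ_snd] at hW1
  nlinarith [mul_le_mul_of_nonneg_left hz hwk.le]

/-- `A` is antitone: `A k' ≤ A k` for `k ≤ k'`. [this work] -/
theorem A_antitone (hw : ∀ k, 0 < w k) {k k' : ℕ} (hkk : k ≤ k') : A w e k' ≤ A w e k := by
  induction hkk with
  | refl => exact le_rfl
  | step _ ih => exact (A_succ_le hw _).trans ih

/-- **TOP-HEAVINESS**: `W n · S k ≥ W k · S n` for `k ≤ n` (the top block's average dominates). [this work] -/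
theorem topheavy (hw : ∀ k, 0 < w k) {k n : ℕ} (hkn : k ≤ n) :
    (SW w e n).2 * ∑ j ∈ range (k + 1), w j * z w e j ≥ (∑ j ∈ range (k + 1), w j) * (SW w e n).1 := by
  have h := A_antitone hw hkn (e := e)
  rw [← SW_fst, ← SW_snd (e := e), S_eq_A_mul_W hw k, S_eq_A_mul_W hw n]
  have hWk := W_pos hw k (e := e); have hWn := W_pos hw n (e := e)
  nlinarith [mul_le_mul_of_nonneg_left h (mul_nonneg hWk.le hWn.le)]

/-! ### Weighted Chebyshev on a block and the lower bound `z ≥ F κ` -/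

/-- Weighted Chebyshev on the block `0..k`: for `u, v` comonotone (both antitone) and `w ≥ 0`,
`(Σ w)(Σ w u v) ≥ (Σ w u)(Σ w v)`. [folklore] -/
theorem chebyshev_block {u v : ℕ → ℝ} (hw : ∀ k, 0 ≤ w k) (hu : Antitone u) (hv : Antitone v) (k : ℕ) :
    (∑ j ∈ range (k + 1), w j) * (∑ j ∈ range (k + 1), w j * (u j * v j)) ≥
      (∑ j ∈ range (k + 1), w j * u j) * ∑ j ∈ range (k + 1), w j * v j := by
  set R := range (k + 1)
  set D := (∑ j ∈ R, w j) * (∑ j ∈ R, w j * (u j * v j)) - (∑ j ∈ R, w j * u j) * ∑ j ∈ R, w j * v j with hDdef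
  let M : ℕ → ℕ → ℝ := fun i j => w i * w j * (v j * (u j - u i))
  have h1 : D = ∑ i ∈ R, ∑ j ∈ R, M i j := by
    rw [hDdef, sum_mul_sum, sum_mul_sum, ← sum_sub_distrib]
    exact sum_congr rfl fun i _ => by rw [← sum_sub_distrib]; exact sum_congr rfl fun j _ => by ring
  have h2 : D = ∑ i ∈ R, ∑ j ∈ R, M j i := by rw [h1, sum_comm]
  have h3 : (∑ i ∈ R, ∑ j ∈ R, (M i j + M j i)) = D + D := by
    rw [show (∑ i ∈ R, ∑ j ∈ R, (M i j + M j i)) = (∑ i ∈ R, ∑ j ∈ R, M i j) + ∑ i ∈ R, ∑ j ∈ R, M j i from by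
      simp only [sum_add_distrib], ← h1, ← h2]
  have key : ∀ i j, 0 ≤ M i j + M j i := by
    intro i j
    have e : M i j + M j i = w i * w j * ((u i - u j) * (v i - v j)) := by ring
    rw [e]
    refine mul_nonneg (mul_nonneg (hw i) (hw j)) ?_
    rcases le_total i j with hij | hji
    · exact mul_nonneg (by linarith [hu hij]) (by linarith [hv hij])
    · exact mul_nonneg_of_nonpos_of_nonpos (by linarith [hu hji]) (by linarith [hv hji])
  have : 0 ≤ D + D := by rw [← h3]; exact sum_nonneg fun i _ => sum_nonneg fun j _ => key i j
  show (∑ j ∈ R, w j * u j) * ∑ j ∈ R, w j * v j ≤ (∑ j ∈ R, w j) * (∑ j ∈ R, w j * (u j * v j))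
  linarith

/-- **`z ≥ F κ` and `A ≥ 0`.**  If `e ≥ F κ` with `F ≥ 0` antitone and `κ` antitone with nonnegative block sums `Σ_{j≤k} w j κ j ≥ 0`
for `k ≤ n`, then `z k ≥ F k κ k` and `A k ≥ 0` for all `k ≤ n`. [this work] -/
theorem z_ge_and_A_nonneg {F κ : ℕ → ℝ} {n : ℕ} (hw : ∀ k, 0 < w k) (hF0 : ∀ k, 0 ≤ F k) (hF : Antitone F) (hκ : Antitone κ)
    (hκs : ∀ k ≤ n, 0 ≤ ∑ j ∈ range (k + 1), w j * κ j) (he : ∀ k, F k * κ k ≤ e k) :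
    ∀ k ≤ n, F k * κ k ≤ z w e k ∧ 0 ≤ A w e k := by
  have hw0 : ∀ k, 0 ≤ w k := fun k => (hw k).le
  -- block step: if z ≥ Fκ on 0..k (k ≤ n) then A k ≥ 0 and A k ≥ F(k+1) κ(k+1)
  have block : ∀ k ≤ n, (∀ j ≤ k, F j * κ j ≤ z w e j) → 0 ≤ A w e k ∧ F (k + 1) * κ (k + 1) ≤ A w e k := by
    intro k hkn hk
    have hW := W_pos hw k (e := e)
    have hWdef : (SW w e k).2 = ∑ j ∈ range (k + 1), w j := SW_snd k
    have hS : (SW w e k).1 ≥ ∑ j ∈ range (k + 1), w j * (F j * κ j) := by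
      rw [SW_fst]; exact sum_le_sum fun j hj => mul_le_mul_of_nonneg_left (hk j (Nat.lt_succ_iff.mp (mem_range.mp hj))) (hw0 j)
    have cheb := chebyshev_block (w := w) hw0 hF hκ k
    rw [← hWdef] at cheb
    have hSK : 0 ≤ ∑ j ∈ range (k + 1), w j * κ j := hκs k hkn
    have hSF0 : 0 ≤ ∑ j ∈ range (k + 1), w j * F j := sum_nonneg fun j _ => mul_nonneg (hw0 j) (hF0 j)
    have hSF : (SW w e k).2 * F (k + 1) ≤ ∑ j ∈ range (k + 1), w j * F j := by
      rw [hWdef, sum_mul]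
      exact sum_le_sum fun j hj => mul_le_mul_of_nonneg_left (hF (mem_range.mp hj).le) (hw0 j)
    have hSKk : (SW w e k).2 * κ (k + 1) ≤ ∑ j ∈ range (k + 1), w j * κ j := by
      rw [hWdef, sum_mul]
      exact sum_le_sum fun j hj => mul_le_mul_of_nonneg_left (hκ (mem_range.mp hj).le) (hw0 j)
    have hA : A w e k * (SW w e k).2 = (SW w e k).1 := by unfold A; exact div_mul_cancel₀ _ hW.ne'
    have h1 : (SW w e k).2 * (SW w e k).1 ≥ (∑ j ∈ range (k + 1), w j * F j) * ∑ j ∈ range (k + 1), w j * κ j :=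
      le_trans cheb (mul_le_mul_of_nonneg_left hS hW.le)
    have hprod0 : 0 ≤ (SW w e k).2 * (SW w e k).1 := le_trans (mul_nonneg hSF0 hSK) h1
    have hA0 : 0 ≤ A w e k := by
      rw [← hA] at hprod0
      have : 0 ≤ (SW w e k).2 * (SW w e k).2 * A w e k := by nlinarith
      exact nonneg_of_mul_nonneg_right (by nlinarith [this]) (mul_pos hW hW)
    refine ⟨hA0, ?_⟩
    by_cases hk1 : 0 ≤ κ (k + 1)
    · have h2 : (∑ j ∈ range (k + 1), w j * F j) * (∑ j ∈ range (k + 1), w j * κ j) ≥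
          ((SW w e k).2 * F (k + 1)) * ((SW w e k).2 * κ (k + 1)) :=
        mul_le_mul hSF hSKk (mul_nonneg hW.le hk1) hSF0
      have h3 : (SW w e k).2 * (A w e k * (SW w e k).2) ≥ (SW w e k).2 * ((SW w e k).2 * (F (k + 1) * κ (k + 1))) := by
        rw [hA]; nlinarith [h1, h2]
      have h4 := le_of_mul_le_mul_left h3 hW
      nlinarith [h4]
    · have : F (k + 1) * κ (k + 1) ≤ 0 := mul_nonpos_of_nonneg_of_nonpos (hF0 _) (not_le.mp hk1).le
      linarith
  have main : ∀ k ≤ n, ∀ j ≤ k, F j * κ j ≤ z w e j := by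
    intro k
    induction k with
    | zero => intro _ j hj; rw [Nat.le_zero.mp hj]; simpa [z] using he 0
    | succ k ih =>
      intro hkn j hj
      rcases Nat.lt_or_ge j (k + 1) with hlt | hge
      · exact ih (Nat.le_of_succ_le hkn) j (Nat.lt_succ_iff.mp hlt)
      · have : j = k + 1 := le_antisymm hj hge
        subst this
        show F (k + 1) * κ (k + 1) ≤ min (e (k + 1)) (A w e k)
        exact le_min (he _) (block k (Nat.le_of_succ_le hkn) (ih (Nat.le_of_succ_le hkn))).2
  exact fun k hkn => ⟨main k hkn k le_rfl, (block k hkn (main k hkn)).1⟩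

end SahiSharedChain

end Summit.CriticalPhenomena.PercolationContinuityZ3.Theorems
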